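import Mathlib
import HarnessLib

/-!
# Korovkin's theorem

**Korovkin's (first) theorem** (P. P. Korovkin 1953): let `K ⊆ ℝ` be compact and let `L n`,
`n ∈ ℕ`, be *positive* linear operators on `C(K, ℝ)`.  If `L n e → e` uniformly for the three test
functions `e = 1, x, x²`, then `L n f → f` uniformly for **every** `f ∈ C(K, ℝ)`
[cite: HammerlinHoffman1991, Ch. 4 §2.3 Theorem and §2.4].  (Hämmerlin–Hoffmann present
E. Schäfer's test-set version; with the test set `{1, x, x²}` and `p(t, x) = (t - x)²` it is the
classical statement proved here.)  The Weierstrass approximation theorem via Bernstein operators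
(Mathlib's `bernsteinApproximation_uniform`) is the model application; neither Mathlib nor the tree
has Korovkin's theorem.

Proof (quadratic majorant): by uniform continuity, `|f t - f s| ≤ ε + (2‖f‖/δ²) (t - s)²`;
apply the positive operator `L n` in `t` and evaluate at `s`; the right-hand side becomes
`ε Lₙ1(s) + c (Lₙx² - 2s Lₙx + s² Lₙ1)(s)`, and `(Lₙx² - 2s Lₙx + s² Lₙ1)(s) → s² - 2s² + s² = 0`
uniformly in `s`.

* `testFun K k` — the test function `x ↦ x^k` in `C(K, ℝ)`;
* `IsPositive L` — positivity of a linear operator on `C(K, ℝ)`; `IsPositive.mono`, `IsPositive.abs_le`;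
* `quadratic_majorant` — the uniform-continuity estimate;
* `norm_sub_le` — the quantitative Korovkin estimate for fixed `ε, δ`;
* `tendsto_of_tendsto_testFun` — **Korovkin's theorem**; `tendsto_of_tendsto_testFun'` — the same
  with `IsCompact K` instead of the instance `CompactSpace K`.
-/

open Filter Topology Set

noncomputable section

namespace Literature.Analysis.Approximation.Korovkin

variable {K : Set ℝ}

/-- The test function `x ↦ x ^ k` on `K`. [folklore] -/
def testFun (K : Set ℝ) (k : ℕ) : C(K, ℝ) := ⟨fun x => (x : ℝ) ^ k, by fun_prop⟩

/-- Evaluation of the test monomial `testFun K k` at `x` is `x ^ k`. [folklore] -/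
@[simp] private theorem testFun_apply (k : ℕ) (x : K) : testFun K k x = (x : ℝ) ^ k := rfl

/-- A linear operator on `C(K, ℝ)` is **positive** if it maps (pointwise) nonnegative functions to
nonnegative functions. [cite: HammerlinHoffman1991, Ch. 4 §2.3] -/
def IsPositive (L : C(K, ℝ) →ₗ[ℝ] C(K, ℝ)) : Prop :=
  ∀ f : C(K, ℝ), (∀ x, 0 ≤ f x) → ∀ x, 0 ≤ L f x

/-- A positive operator is monotone. [cite: HammerlinHoffman1991, Ch. 4 §2.3] -/
theorem IsPositive.mono {L : C(K, ℝ) →ₗ[ℝ] C(K, ℝ)} (hL : IsPositive L) {f g : C(K, ℝ)}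
    (h : ∀ x, f x ≤ g x) (x : K) : L f x ≤ L g x := by
  have h1 := hL (g - f) (fun y => by simpa [sub_nonneg] using h y) x
  rw [map_sub, ContinuousMap.sub_apply, sub_nonneg] at h1
  exact h1

/-- A positive operator satisfies `|L f| ≤ L g` whenever `|f| ≤ g`. [folklore] -/
private theorem IsPositive.abs_le {L : C(K, ℝ) →ₗ[ℝ] C(K, ℝ)} (hL : IsPositive L) {f g : C(K, ℝ)}
    (h : ∀ x, |f x| ≤ g x) (x : K) : |L f x| ≤ L g x := by
  rw [_root_.abs_le]
  constructor
  · have h1 := hL.mono (f := -g) (g := f) (fun y => by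
      have := (_root_.abs_le.mp (h y)).1
      simpa using this) x
    simpa using h1
  · exact hL.mono (fun y => (le_abs_self _).trans (h y)) x

/-- For a positive operator, `0 ≤ L 1 x ≤ 1 + ‖L 1 - 1‖`. [folklore] -/
private theorem IsPositive.testFun_zero_le {L : C(K, ℝ) →ₗ[ℝ] C(K, ℝ)} [CompactSpace K] (x : K) :
    L (testFun K 0) x ≤ 1 + ‖L (testFun K 0) - testFun K 0‖ := by
  have h := ContinuousMap.norm_coe_le_norm (L (testFun K 0) - testFun K 0) x
  rw [ContinuousMap.sub_apply, testFun_apply, pow_zero, Real.norm_eq_abs, _root_.abs_le] at h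
  linarith [h.2]

/-- The quadratic majorant furnished by uniform continuity: if `dist t s < δ ⇒ |f t - f s| < ε`, then
`|f t - f s| ≤ ε + (2 ‖f‖ / δ²) (t - s)²` for all `s, t`. [cite: HammerlinHoffman1991, Ch. 4 §2.3 (b)] -/
theorem quadratic_majorant [CompactSpace K] (f : C(K, ℝ)) {ε δ : ℝ} (hε : 0 ≤ ε) (hδ : 0 < δ)
    (h : ∀ s t : K, dist t s < δ → dist (f t) (f s) < ε) (s t : K) :
    |f t - f s| ≤ ε + 2 * ‖f‖ / δ ^ 2 * ((t : ℝ) - s) ^ 2 := by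
  have hc : 0 ≤ 2 * ‖f‖ / δ ^ 2 := by positivity
  by_cases hts : dist t s < δ
  · have := h s t hts
    rw [Real.dist_eq] at this
    nlinarith [sq_nonneg ((t : ℝ) - s)]
  · push Not at hts
    have hd : δ ≤ |(t : ℝ) - s| := by
      have : dist t s = |(t : ℝ) - s| := by rw [Subtype.dist_eq, Real.dist_eq]
      rw [← this]; exact hts
    have h2 : |f t - f s| ≤ 2 * ‖f‖ := by
      calc |f t - f s| ≤ |f t| + |f s| := abs_sub _ _
        _ ≤ ‖f‖ + ‖f‖ := add_le_add (by simpa using f.norm_coe_le_norm t)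
            (by simpa using f.norm_coe_le_norm s)
        _ = 2 * ‖f‖ := by ring
    have hsq : δ ^ 2 ≤ ((t : ℝ) - s) ^ 2 := by
      rw [← sq_abs ((t : ℝ) - s)]
      exact pow_le_pow_left₀ hδ.le hd 2
    have h3 : 2 * ‖f‖ ≤ 2 * ‖f‖ / δ ^ 2 * ((t : ℝ) - s) ^ 2 := by
      rw [div_mul_eq_mul_div, le_div_iff₀ (by positivity)]
      exact mul_le_mul_of_nonneg_left hsq (by positivity)
    linarith

/-- The quadratic test polynomial centred at `s`: `q s = x² - 2 s x + s² · 1`, so `q s t = (t - s)²`.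
[folklore] -/
def quad (K : Set ℝ) (s : K) : C(K, ℝ) :=
  testFun K 2 - (2 * (s : ℝ)) • testFun K 1 + ((s : ℝ) ^ 2) • testFun K 0

/-- Evaluation of the quadratic test function `quad K s` at `t` is `(t - s) ^ 2`. [folklore] -/
@[simp] private theorem quad_apply (s t : K) : quad K s t = ((t : ℝ) - s) ^ 2 := by
  simp [quad]
  ring

/-- The value `L (q s) (s)` of a positive operator on the centred quadratic is controlled by the
errors on the three test functions: `|L (q s) s| ≤ ‖L x² - x²‖ + 2 |s| ‖L x - x‖ + s² ‖L 1 - 1‖`.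
[cite: HammerlinHoffman1991, Ch. 4 §2.4] -/
theorem abs_apply_quad_le [CompactSpace K] (L : C(K, ℝ) →ₗ[ℝ] C(K, ℝ)) (s : K) :
    |L (quad K s) s| ≤ ‖L (testFun K 2) - testFun K 2‖ + 2 * |(s : ℝ)| * ‖L (testFun K 1) - testFun K 1‖
      + (s : ℝ) ^ 2 * ‖L (testFun K 0) - testFun K 0‖ := by
  have hq : L (quad K s) s = (L (testFun K 2) - testFun K 2) s
      - 2 * (s : ℝ) * (L (testFun K 1) - testFun K 1) s + (s : ℝ) ^ 2 * (L (testFun K 0) - testFun K 0) s := by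
    simp only [quad, map_add, map_sub, map_smul, ContinuousMap.add_apply, ContinuousMap.sub_apply,
      ContinuousMap.smul_apply, smul_eq_mul, testFun_apply]
    ring
  rw [hq]
  have h2 := ContinuousMap.norm_coe_le_norm (L (testFun K 2) - testFun K 2) s
  have h1 := ContinuousMap.norm_coe_le_norm (L (testFun K 1) - testFun K 1) s
  have h0 := ContinuousMap.norm_coe_le_norm (L (testFun K 0) - testFun K 0) s
  rw [Real.norm_eq_abs] at h2 h1 h0
  set A := (L (testFun K 2) - testFun K 2) s
  set B := (L (testFun K 1) - testFun K 1) s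
  set C := (L (testFun K 0) - testFun K 0) s
  calc |A - 2 * (s : ℝ) * B + (s : ℝ) ^ 2 * C|
      ≤ |A - 2 * (s : ℝ) * B| + |(s : ℝ) ^ 2 * C| := abs_add_le _ _
    _ ≤ |A| + |2 * (s : ℝ) * B| + |(s : ℝ) ^ 2 * C| := by gcongr; exact abs_sub _ _
    _ ≤ _ := by
      rw [abs_mul, abs_mul, abs_mul, abs_of_nonneg (by norm_num : (0 : ℝ) ≤ 2), abs_pow, sq_abs]
      gcongr

/-- **The Korovkin estimate.** For a positive operator `L`, `f ∈ C(K, ℝ)` and `ε, δ` as in the uniform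
continuity of `f`: for every `s ∈ K`,
`|L f s - f s| ≤ ε (1 + ‖L1 - 1‖) + ‖f‖ ‖L1 - 1‖ + (2‖f‖/δ²) (‖Lx² - x²‖ + 2|s| ‖Lx - x‖ + s² ‖L1 - 1‖)`.
[cite: HammerlinHoffman1991, Ch. 4 §2.3 Theorem (proof)] -/
theorem abs_apply_sub_le [CompactSpace K] {L : C(K, ℝ) →ₗ[ℝ] C(K, ℝ)} (hL : IsPositive L)
    (f : C(K, ℝ)) {ε δ : ℝ} (hε : 0 ≤ ε) (hδ : 0 < δ)
    (h : ∀ s t : K, dist t s < δ → dist (f t) (f s) < ε) (s : K) :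
    |L f s - f s| ≤ ε * (1 + ‖L (testFun K 0) - testFun K 0‖) + ‖f‖ * ‖L (testFun K 0) - testFun K 0‖
      + 2 * ‖f‖ / δ ^ 2 * (‖L (testFun K 2) - testFun K 2‖ + 2 * |(s : ℝ)| * ‖L (testFun K 1) - testFun K 1‖
        + (s : ℝ) ^ 2 * ‖L (testFun K 0) - testFun K 0‖) := by
  set c : ℝ := 2 * ‖f‖ / δ ^ 2 with hc_def
  have hc : 0 ≤ c := by positivity
  set a0 : ℝ := ‖L (testFun K 0) - testFun K 0‖
  -- the centred difference `g = f - f(s)·1` and its quadratic majorant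
  set g : C(K, ℝ) := f - (f s) • testFun K 0 with hg_def
  have hmaj : ∀ t, |g t| ≤ (ε • testFun K 0 + c • quad K s) t := by
    intro t
    simp only [hg_def, ContinuousMap.sub_apply, ContinuousMap.smul_apply, ContinuousMap.add_apply,
      smul_eq_mul, testFun_apply, pow_zero, mul_one, quad_apply]
    exact quadratic_majorant f hε hδ h s t
  have hLg : |L g s| ≤ L (ε • testFun K 0 + c • quad K s) s := hL.abs_le hmaj s
  have hLg' : |L g s| ≤ ε * L (testFun K 0) s + c * L (quad K s) s := by
    simpa only [map_add, map_smul, ContinuousMap.add_apply, ContinuousMap.smul_apply, smul_eq_mul]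
      using hLg
  -- `L f s - f s = L g s + f s · (L 1 s - 1)`
  have hsplit : L f s - f s = L g s + f s * (L (testFun K 0) - testFun K 0) s := by
    simp only [hg_def, map_sub, map_smul, ContinuousMap.sub_apply, ContinuousMap.smul_apply, smul_eq_mul,
      testFun_apply, pow_zero]
    ring
  have hfs : |f s| ≤ ‖f‖ := by simpa using f.norm_coe_le_norm s
  have h0s : |(L (testFun K 0) - testFun K 0) s| ≤ a0 := by
    simpa using ContinuousMap.norm_coe_le_norm (L (testFun K 0) - testFun K 0) s
  have hL1 : L (testFun K 0) s ≤ 1 + a0 := IsPositive.testFun_zero_le s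
  have hq := abs_apply_quad_le L s
  rw [hsplit]
  have hfa : |f s * (L (testFun K 0) - testFun K 0) s| ≤ ‖f‖ * a0 := by
    rw [abs_mul]; exact mul_le_mul hfs h0s (abs_nonneg _) (norm_nonneg _)
  have hcq : c * L (quad K s) s ≤ c * (‖L (testFun K 2) - testFun K 2‖
      + 2 * |(s : ℝ)| * ‖L (testFun K 1) - testFun K 1‖ + (s : ℝ) ^ 2 * a0) :=
    mul_le_mul_of_nonneg_left ((le_abs_self _).trans hq) hc
  have hε1 : ε * L (testFun K 0) s ≤ ε * (1 + a0) := mul_le_mul_of_nonneg_left hL1 hε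
  have htri : |L g s + f s * (L (testFun K 0) - testFun K 0) s|
      ≤ |L g s| + |f s * (L (testFun K 0) - testFun K 0) s| := abs_add_le _ _
  linarith

/-- **Korovkin's theorem.** Let `K ⊆ ℝ` be compact and `L n` positive linear operators on `C(K, ℝ)`
with `L n 1 → 1`, `L n x → x`, `L n x² → x²` uniformly. Then `L n f → f` uniformly for every
`f ∈ C(K, ℝ)`. [cite: HammerlinHoffman1991, Ch. 4 §2.3 Theorem, §2.4] -/
theorem tendsto_of_tendsto_testFun [CompactSpace K] (L : ℕ → C(K, ℝ) →ₗ[ℝ] C(K, ℝ))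
    (hL : ∀ n, IsPositive (L n))
    (h0 : Tendsto (fun n => L n (testFun K 0)) atTop (𝓝 (testFun K 0)))
    (h1 : Tendsto (fun n => L n (testFun K 1)) atTop (𝓝 (testFun K 1)))
    (h2 : Tendsto (fun n => L n (testFun K 2)) atTop (𝓝 (testFun K 2)))
    (f : C(K, ℝ)) : Tendsto (fun n => L n f) atTop (𝓝 f) := by
  -- errors on the test functions
  set a0 : ℕ → ℝ := fun n => ‖L n (testFun K 0) - testFun K 0‖
  set a1 : ℕ → ℝ := fun n => ‖L n (testFun K 1) - testFun K 1‖
  set a2 : ℕ → ℝ := fun n => ‖L n (testFun K 2) - testFun K 2‖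
  have ha0 : Tendsto a0 atTop (𝓝 0) := tendsto_iff_norm_sub_tendsto_zero.mp h0
  have ha1 : Tendsto a1 atTop (𝓝 0) := tendsto_iff_norm_sub_tendsto_zero.mp h1
  have ha2 : Tendsto a2 atTop (𝓝 0) := tendsto_iff_norm_sub_tendsto_zero.mp h2
  -- `|s| ≤ R` on `K`
  set R : ℝ := ‖testFun K 1‖
  have hR : ∀ s : K, |(s : ℝ)| ≤ R := fun s => by simpa using (testFun K 1).norm_coe_le_norm s
  rw [Metric.tendsto_atTop]
  intro ε' hε'
  -- uniform continuity of `f` at scale `ε = ε'/3`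
  set ε : ℝ := ε' / 3
  have hε : 0 < ε := by positivity
  obtain ⟨δ, hδ, hfδ⟩ := Metric.uniformContinuous_iff.mp
    (CompactSpace.uniformContinuous_of_continuous f.continuous) ε hε
  set c : ℝ := 2 * ‖f‖ / δ ^ 2
  have hc : 0 ≤ c := by positivity
  -- the error bound `(ε + ‖f‖) a0 n + c (a2 n + 2 R a1 n + R² a0 n)` tends to `0`
  have hb : Tendsto (fun n => (ε + ‖f‖) * a0 n + c * (a2 n + 2 * R * a1 n + R ^ 2 * a0 n)) atTop (𝓝 0) := by
    have h := (ha0.const_mul (ε + ‖f‖)).add ((ha2.add ((ha1.const_mul (2 * R)).add (ha0.const_mul (R ^ 2)))).const_mul c)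
    simp only [mul_zero, add_zero] at h
    exact h.congr fun n => by ring
  obtain ⟨N, hN⟩ := eventually_atTop.mp (hb.eventually (eventually_lt_nhds (show (0 : ℝ) < 2 * ε by positivity)))
  refine ⟨N, fun n hn => ?_⟩
  have hNn := hN n hn
  rw [dist_eq_norm]
  have hR0 : 0 ≤ R := norm_nonneg _
  have ha0n : 0 ≤ a0 n := norm_nonneg _
  have ha1n : 0 ≤ a1 n := norm_nonneg _
  have ha2n : 0 ≤ a2 n := norm_nonneg _
  have hpos : 0 ≤ ε + ((ε + ‖f‖) * a0 n + c * (a2 n + 2 * R * a1 n + R ^ 2 * a0 n)) := by positivity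
  have hbound : ‖L n f - f‖ ≤ ε + ((ε + ‖f‖) * a0 n + c * (a2 n + 2 * R * a1 n + R ^ 2 * a0 n)) := by
    refine (ContinuousMap.norm_le _ hpos).2 fun s => ?_
    rw [ContinuousMap.sub_apply, Real.norm_eq_abs]
    have hs := abs_apply_sub_le (hL n) f hε.le hδ (fun s t hst => hfδ hst) s
    have hRs := hR s
    have hs2 : (s : ℝ) ^ 2 ≤ R ^ 2 := by
      rw [← sq_abs (s : ℝ)]; exact pow_le_pow_left₀ (abs_nonneg _) hRs 2
    calc |L n f s - f s| ≤ ε * (1 + a0 n) + ‖f‖ * a0 n + c * (a2 n + 2 * |(s : ℝ)| * a1 n + (s : ℝ) ^ 2 * a0 n) := hs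
      _ ≤ ε * (1 + a0 n) + ‖f‖ * a0 n + c * (a2 n + 2 * R * a1 n + R ^ 2 * a0 n) := by gcongr
      _ = _ := by ring
  calc ‖L n f - f‖ ≤ _ := hbound
    _ < ε + 2 * ε := by linarith
    _ = ε' := by simp only [ε]; ring

/-- **Korovkin's theorem**, with the compactness of `K` as a hypothesis.
[cite: HammerlinHoffman1991, Ch. 4 §2.3 Theorem, §2.4] -/
theorem tendsto_of_tendsto_testFun' (hK : IsCompact K) (L : ℕ → C(K, ℝ) →ₗ[ℝ] C(K, ℝ))
    (hL : ∀ n, IsPositive (L n))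
    (h0 : Tendsto (fun n => L n (testFun K 0)) atTop (𝓝 (testFun K 0)))
    (h1 : Tendsto (fun n => L n (testFun K 1)) atTop (𝓝 (testFun K 1)))
    (h2 : Tendsto (fun n => L n (testFun K 2)) atTop (𝓝 (testFun K 2)))
    (f : C(K, ℝ)) : Tendsto (fun n => L n f) atTop (𝓝 f) := by
  haveI : CompactSpace K := isCompact_iff_compactSpace.mp hK
  exact tendsto_of_tendsto_testFun L hL h0 h1 h2 f

#harness_tags tendsto_of_tendsto_testFun

end Literature.Analysis.Approximation.Korovkin
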